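import Summits.HodgeConjecture.CorCM.MumfordTateRankSixIsogeny
import Summits.HodgeConjecture.CorCM.MumfordTateRankFiveHodge
import Summits.HodgeConjecture.CorCM.CMAbelianVarietyDimLeThreePowers
import HarnessLib

/-!
# The rungs `dim MT(H¹(X)) ≤ 6`, `X` NOT of CM type, IV: the Hodge conjecture for `X` and its powers reduces to the
# Hodge conjecture for the powers of its CM part; unconditionally for `dim X ≤ 4`

COR-CM (cell `pub-hodgecm2`, seat `b27` gen 37, count-neutral lane MT-RANK-SIX-ISOGENY; theorems only, no definition,
no named fact).  HC_CM is NOT proved and is NOT used: the Hodge conjecture for the CM part enters ONLY as an explicit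
hypothesis of the conditional statements; the unconditional statements use the tree's theorem for powers of CM abelian
varieties of dimension `≤ 3` (`hodgeConjectureFor_powSucc_of_isOfCMType_of_dim_le_three`, `B = D`).

By `CorCM/MumfordTateRankSixIsogeny`, a complex abelian variety `X` with `dim [Lie Hg(H¹X), Lie Hg(H¹X)] = 3` (Hodge
group of semisimple rank one; in particular every `X` NOT of CM type with `dim MT(H¹X) ≤ 6`) is isogenous
to `B^{m+1} × Z`, `B` simple NOT of CM type with `dim End⁰(B) = (dim B)²`, `dim B ≤ 2` (so `Lie Hg(H¹B) = 𝔰𝔩₂`: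
`not_le_endAlg_and_finrank_hodgeLie_le_three_of_factor`), `Z` of CM type, `dim Z < dim X`.  Hence
`X^{N+1} ≼ B^{K+1} × Z^{K+1}` (`K = m + N(m+1)`, domination bookkeeping of `CorCM/MumfordTateRankFiveHodge`), and the
`𝔰𝔩₂`-isotypic product theorem `hodgeConjectureFor_powSucc_prod_powSucc_of_finrank_hodgeLie_le_three_of_isOfCMType`
(Moonen–Zarhin (3.2) / Lombardo 3.4, proved in the tree) transfers HC(`Z^{K+1}`) to HC(`B^{K+1} × Z^{K+1}`), which
descends to `X^{N+1}`:

* `exists_avDominatedBy_powSucc_prod_powSucc_of_finrank_derived_eq_three` / `…_of_mtRank_le_six` — the domination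
  `X^{N+1} ≼ B^{K+1} × Z^{K+1}`.
* **`hodgeConjectureFor_powSucc_of_finrank_derived_eq_three_of_cm_powers`** / `…_of_mtRank_le_six_of_cm_powers` —
  CONDITIONAL: if every power of every CM abelian variety of dimension `< dim X` satisfies HC, then every power of `X`
  does (and `X` itself, `hodgeConjectureFor_of_mtRank_le_six_of_cm_powers`).
* **`hodgeConjectureFor_powSucc_of_finrank_derived_eq_three_of_dim_le_four`** / `…_of_mtRank_le_six_of_dim_le_four` —
  UNCONDITIONAL: every power of every complex abelian variety `X` with `dim [Lie Hg, Lie Hg] = 3` (in particular `X`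
  NOT of CM type with `dim MT(H¹X) ≤ 6`) and `dim X ≤ 4` satisfies the Hodge conjecture (the CM part has dimension `≤ 3`).

## References

* [MoonenZarhin1999LowDim] B. Moonen, Yu. Zarhin, *Hodge classes on abelian varieties of low dimension*, Math. Ann.
  315 (1999), §2 (2.1)–(2.5), §3 (3.1)–(3.2), (3.8), §5 (5.2).
* [Lombardo2016] D. Lombardo, *On the ℓ-adic Galois representations attached to nonsimple abelian varieties*,
  Ann. Inst. Fourier 66 (2016), Lemma 3.4 (p. 1229).
* [Gordon1999HodgeAVSurvey] B. B. Gordon, *A survey of the Hodge conjecture for abelian varieties* (1999), §7.3.2, 7.5.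
* [MumfordAV1970] D. Mumford, *Abelian Varieties* (1970), §19 Thm. 1 and p. 169.
* [vanGeemen1994HodgeAV] B. van Geemen, *An introduction to the Hodge conjecture for abelian varieties* (1994), Lemma 3.7.
-/

noncomputable section

open CategoryTheory CategoryTheory.Limits Module

namespace Summit.HodgeConjecture.CorCM

open Literature.AlgebraicGeometry.Motives
open Literature.AlgebraicGeometry.Motives.AbelianVariety
open Literature.AlgebraicGeometry.Motives.HodgeStructure
open Literature.AlgebraicGeometry.HodgeTheory
open Literature.AlgebraicGeometry.Milne1999 (IsOfCMType)
open Summit.HodgeConjecture.CorCM.Domination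

variable [HodgeTensorFacts.{0, 0}] {X : AbelianVariety ℂ} {n : ℕ}

/-! ## §1 Semisimple rank one: `dim [Lie Hg(H¹X), Lie Hg(H¹X)] = 3` -/

/-- **`X^{N+1} ≼ B^{K+1} × Z^{K+1}`**: for `X` with `dim [Lie Hg(H¹X), Lie Hg(H¹X)] = 3`, the factors `B` (simple, NOT of
CM type, `0 < dim B ≤ 2`, `dim End⁰(B) = (dim B)²`) and `Z` (of CM type, `dim Z < dim X`) of
`exists_isIsogenous_powSucc_prod_of_finrank_derived_eq_three` dominate every power: `X^{N+1} ∼ (B^{m+1} × Z)^{N+1} ≼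
(B^{m+1})^{N+1} × (Z^{m+1})^{N+1} ≼ B^{K+1} × Z^{K+1}`, `K = m + N(m+1)`.
[cite: MoonenZarhin1999LowDim, §2 (2.1)–(2.5)] [cite: MumfordAV1970, §19 Thm. 1 and p. 169] -/
theorem exists_avDominatedBy_powSucc_prod_powSucc_of_finrank_derived_eq_three (hX : IsSmoothProjective n X.X)
    (h0 : 0 < X.dim)
    (h3 : haveI := BettiUniverse.finite hX 1
      Module.finrank ℚ ↥(Submodule.span ℚ {B | ∃ X' ∈ (BettiUniverse.hodge exists_isReal_hodgeModel_holds hX 1).hodgeLie,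
        ∃ Y ∈ (BettiUniverse.hodge exists_isReal_hodgeModel_holds hX 1).hodgeLie, X' * Y - Y * X' = B}) = 3) :
    ∃ (B Z : AbelianVariety ℂ) (m : ℕ), B.IsSimple ∧ 0 < B.dim ∧ B.dim ≤ 2 ∧ ¬ IsOfCMType B ∧
      Module.finrank ℚ B.endAlgebra = B.dim ^ 2 ∧ IsOfCMType Z ∧ Z.dim < X.dim ∧ (m + 1) * B.dim + Z.dim = X.dim ∧
      ∀ N : ℕ, AVDominatedBy (X.powSucc N) ((B.powSucc (m + N * (m + 1))).prod (Z.powSucc (m + N * (m + 1)))) := by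
  obtain ⟨B, Z, m, hBs, hB0, hB2, hBcm, hfinB, -, hZcm, hXYZ, hdims, -⟩ :=
    exists_isIsogenous_powSucc_prod_of_finrank_derived_eq_three hX h0 h3
  have hZlt : Z.dim < X.dim := by
    have : 0 < (m + 1) * B.dim := Nat.mul_pos (Nat.succ_pos m) hB0
    omega
  have hdom : AVDominatedBy X ((B.powSucc m).prod (Z.powSucc m)) :=
    (AVDominatedBy.of_isIsogenous hXYZ (AVDominatedBy.refl _)).trans
      ((AVDominatedBy.refl _).prod (avDominatedBy_powSucc_of_le Z (Nat.zero_le m)))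
  refine ⟨B, Z, m, hBs, hB0, hB2, hBcm, hfinB, hZcm, hZlt, hdims, fun N => ?_⟩
  exact (avDominatedBy_powSucc_of_avDominatedBy hdom N).trans ((avDominatedBy_powSucc_prod _ _ N).trans
    ((avDominatedBy_powSucc_powSucc B m N).prod (avDominatedBy_powSucc_powSucc Z m N)))

/-- **HC for the powers of the CM part ⟹ HC for all powers of `X`** (`dim [Lie Hg(H¹X), Lie Hg(H¹X)] = 3`),
CONDITIONAL on the stated hypothesis only: if every power of every complex abelian variety OF CM TYPE of dimension
`< dim X` satisfies the Hodge conjecture, then so does every power `X^{N+1}` — by the domination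
`X^{N+1} ≼ B^{K+1} × Z^{K+1}` and the `𝔰𝔩₂`-isotypic product theorem (HC for `B^{K+1}` is Murty's theorem, HC for
`Z^{K+1}` is the hypothesis).  HC_CM is NOT asserted. [cite: MoonenZarhin1999LowDim, §3 (3.2) and (3.8)]
[cite: Lombardo2016, Lemma 3.4 (p. 1229)] [cite: Gordon1999HodgeAVSurvey, §7.3.2 and 7.5] -/
theorem hodgeConjectureFor_powSucc_of_finrank_derived_eq_three_of_cm_powers (hX : IsSmoothProjective n X.X)
    (h0 : 0 < X.dim)
    (h3 : haveI := BettiUniverse.finite hX 1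
      Module.finrank ℚ ↥(Submodule.span ℚ {B | ∃ X' ∈ (BettiUniverse.hodge exists_isReal_hodgeModel_holds hX 1).hodgeLie,
        ∃ Y ∈ (BettiUniverse.hodge exists_isReal_hodgeModel_holds hX 1).hodgeLie, X' * Y - Y * X' = B}) = 3)
    (hCM : ∀ Z : AbelianVariety ℂ, IsOfCMType Z → Z.dim < X.dim →
      ∀ K : ℕ, HodgeConjectureFor (Z.powSucc K).dim (Z.powSucc K).X) (N : ℕ) :
    HodgeConjectureFor (X.powSucc N).dim (X.powSucc N).X := by
  obtain ⟨B, Z, m, hBs, hB0, hB2, hBcm, hfinB, hZcm, hZlt, -, hdom⟩ :=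
    exists_avDominatedBy_powSucc_prod_powSucc_of_finrank_derived_eq_three hX h0 h3
  obtain ⟨hne, h3B⟩ := not_le_endAlg_and_finrank_hodgeLie_le_three_of_factor hBs hB0 hBcm hfinB hB2
  exact hodgeConjectureFor_of_avDominatedBy
    (hodgeConjectureFor_powSucc_prod_powSucc_of_finrank_hodgeLie_le_three_of_isOfCMType hne h3B hZcm _
      (hCM Z hZcm hZlt _)) (hdom N)

/-- **UNCONDITIONAL: the Hodge conjecture for ALL POWERS of every complex abelian variety `X` with
`dim [Lie Hg(H¹X), Lie Hg(H¹X)] = 3` and `dim X ≤ 4`** — the CM part `Z` has `dim Z < dim X ≤ 4`, and every power of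
a CM abelian variety of dimension `≤ 3` satisfies HC (`hodgeConjectureFor_powSucc_of_isOfCMType_of_dim_le_three`,
`B = D`). [cite: MoonenZarhin1999LowDim, §2 (2.1)–(2.5), §3 (3.2) and §5 (5.2)]
[cite: Gordon1999HodgeAVSurvey, §7.3.2, 7.5 and 10.10] -/
theorem hodgeConjectureFor_powSucc_of_finrank_derived_eq_three_of_dim_le_four (hX : IsSmoothProjective n X.X)
    (h0 : 0 < X.dim)
    (h3 : haveI := BettiUniverse.finite hX 1
      Module.finrank ℚ ↥(Submodule.span ℚ {B | ∃ X' ∈ (BettiUniverse.hodge exists_isReal_hodgeModel_holds hX 1).hodgeLie,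
        ∃ Y ∈ (BettiUniverse.hodge exists_isReal_hodgeModel_holds hX 1).hodgeLie, X' * Y - Y * X' = B}) = 3)
    (h4 : X.dim ≤ 4) (N : ℕ) : HodgeConjectureFor (X.powSucc N).dim (X.powSucc N).X :=
  hodgeConjectureFor_powSucc_of_finrank_derived_eq_three_of_cm_powers hX h0 h3
    (fun _ hZcm hZlt K => hodgeConjectureFor_powSucc_of_isOfCMType_of_dim_le_three hZcm (by omega) K) N

/-! ## §2 Mumford–Tate rank `≤ 6`, `X` not of CM type (then `dim [Lie Hg, Lie Hg] = 3`) -/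

/-- **`X^{N+1} ≼ B^{K+1} × Z^{K+1}`** for `X` NOT of CM type with `dim MT(H¹X) ≤ 6` (`finrank_derived_eq_three_of_mtRank_le_six`).
[cite: MoonenZarhin1999LowDim, §2 (2.1)–(2.5)] [cite: MumfordAV1970, §19 Thm. 1 and p. 169] -/
theorem exists_avDominatedBy_powSucc_prod_powSucc_of_mtRank_le_six (hX : IsSmoothProjective n X.X) (h0 : 0 < X.dim)
    (hcm : ¬ IsOfCMType X)
    (h6 : haveI := BettiUniverse.finite hX 1
      (BettiUniverse.hodge exists_isReal_hodgeModel_holds hX 1).mtRank ≤ 6) :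
    ∃ (B Z : AbelianVariety ℂ) (m : ℕ), B.IsSimple ∧ 0 < B.dim ∧ B.dim ≤ 2 ∧ ¬ IsOfCMType B ∧
      Module.finrank ℚ B.endAlgebra = B.dim ^ 2 ∧ IsOfCMType Z ∧ Z.dim < X.dim ∧ (m + 1) * B.dim + Z.dim = X.dim ∧
      ∀ N : ℕ, AVDominatedBy (X.powSucc N) ((B.powSucc (m + N * (m + 1))).prod (Z.powSucc (m + N * (m + 1)))) :=
  exists_avDominatedBy_powSucc_prod_powSucc_of_finrank_derived_eq_three hX h0
    (finrank_derived_eq_three_of_mtRank_le_six hX h0 hcm h6).1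

/-- **HC for the powers of the CM part ⟹ HC for all powers of `X`** (`X` NOT of CM type, `dim MT(H¹X) ≤ 6`),
CONDITIONAL on the stated hypothesis only (HC for all powers of all CM abelian varieties of dimension `< dim X`);
HC_CM is NOT asserted. [cite: MoonenZarhin1999LowDim, §3 (3.2) and (3.8)] [cite: Lombardo2016, Lemma 3.4 (p. 1229)]
[cite: Gordon1999HodgeAVSurvey, §7.3.2 and 7.5] -/
theorem hodgeConjectureFor_powSucc_of_mtRank_le_six_of_cm_powers (hX : IsSmoothProjective n X.X) (h0 : 0 < X.dim)
    (hcm : ¬ IsOfCMType X)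
    (h6 : haveI := BettiUniverse.finite hX 1
      (BettiUniverse.hodge exists_isReal_hodgeModel_holds hX 1).mtRank ≤ 6)
    (hCM : ∀ Z : AbelianVariety ℂ, IsOfCMType Z → Z.dim < X.dim →
      ∀ K : ℕ, HodgeConjectureFor (Z.powSucc K).dim (Z.powSucc K).X) (N : ℕ) :
    HodgeConjectureFor (X.powSucc N).dim (X.powSucc N).X :=
  hodgeConjectureFor_powSucc_of_finrank_derived_eq_three_of_cm_powers hX h0
    (finrank_derived_eq_three_of_mtRank_le_six hX h0 hcm h6).1 hCM N

/-- **… in particular for `X` itself** (`X = X^{0+1}`). [cite: MoonenZarhin1999LowDim, §3 (3.2) and (3.8)] -/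
theorem hodgeConjectureFor_of_mtRank_le_six_of_cm_powers (hX : IsSmoothProjective n X.X) (h0 : 0 < X.dim)
    (hcm : ¬ IsOfCMType X)
    (h6 : haveI := BettiUniverse.finite hX 1
      (BettiUniverse.hodge exists_isReal_hodgeModel_holds hX 1).mtRank ≤ 6)
    (hCM : ∀ Z : AbelianVariety ℂ, IsOfCMType Z → Z.dim < X.dim →
      ∀ K : ℕ, HodgeConjectureFor (Z.powSucc K).dim (Z.powSucc K).X) :
    HodgeConjectureFor X.dim X.X :=
  hodgeConjectureFor_powSucc_of_mtRank_le_six_of_cm_powers hX h0 hcm h6 hCM 0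

/-- **The isogeny classes of the powers**: everything isogenous to some `X^{N+1}` satisfies HC under the same
hypothesis (van Geemen Lemma 3.7). [cite: vanGeemen1994HodgeAV, §3.5–3.7 Lemma 3.7] -/
theorem hodgeConjectureFor_of_isIsogenous_powSucc_of_mtRank_le_six_of_cm_powers (hX : IsSmoothProjective n X.X)
    (h0 : 0 < X.dim)
    (hcm : ¬ IsOfCMType X)
    (h6 : haveI := BettiUniverse.finite hX 1
      (BettiUniverse.hodge exists_isReal_hodgeModel_holds hX 1).mtRank ≤ 6)
    (hCM : ∀ Z : AbelianVariety ℂ, IsOfCMType Z → Z.dim < X.dim →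
      ∀ K : ℕ, HodgeConjectureFor (Z.powSucc K).dim (Z.powSucc K).X)
    {A : AbelianVariety ℂ} {N : ℕ} (hA : A.IsIsogenous (X.powSucc N)) : HodgeConjectureFor A.dim A.X :=
  HodgeConjectureFor.of_isIsogenous hA (hodgeConjectureFor_powSucc_of_mtRank_le_six_of_cm_powers hX h0 hcm h6 hCM N)

/-- **UNCONDITIONAL: the Hodge conjecture for ALL POWERS of every complex abelian variety `X` NOT of CM type with
`dim MT(H¹(X)) ≤ 6` and `dim X ≤ 4`.**  The CM part `Z` of `X ∼ B^{m+1} × Z` has `dim Z < dim X ≤ 4`, and every power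
of a CM abelian variety of dimension `≤ 3` satisfies HC (`hodgeConjectureFor_powSucc_of_isOfCMType_of_dim_le_three`,
`B = D`).  (For `dim MT ≤ 5` and any `dim X` this is `CorCM/MumfordTateRankFiveHodge`; new here is `dim MT = 6`:
`Hg = SL₂ × T²`, e.g. `E × S`, `E × E₁ × E₂`, `Q × S`, `E² × S` with `E` non-CM, `Q` a QM surface, `S` a simple CM surface,
`E₁ ≁ E₂` CM curves — and all their powers.)
[cite: MoonenZarhin1999LowDim, §2 (2.1)–(2.5), §3 (3.2) and §5 (5.2)] [cite: Gordon1999HodgeAVSurvey, §7.3.2, 7.5 and 10.10] -/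
theorem hodgeConjectureFor_powSucc_of_mtRank_le_six_of_dim_le_four (hX : IsSmoothProjective n X.X) (h0 : 0 < X.dim)
    (hcm : ¬ IsOfCMType X)
    (h6 : haveI := BettiUniverse.finite hX 1
      (BettiUniverse.hodge exists_isReal_hodgeModel_holds hX 1).mtRank ≤ 6)
    (h4 : X.dim ≤ 4) (N : ℕ) : HodgeConjectureFor (X.powSucc N).dim (X.powSucc N).X :=
  hodgeConjectureFor_powSucc_of_mtRank_le_six_of_cm_powers hX h0 hcm h6
    (fun _ hZcm hZlt K => hodgeConjectureFor_powSucc_of_isOfCMType_of_dim_le_three hZcm (by omega) K) N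

/-- **UNCONDITIONAL, the variety itself and its isogeny class**: every complex abelian variety isogenous to a power of
an `X` NOT of CM type with `dim MT(H¹(X)) ≤ 6` and `dim X ≤ 4` satisfies the Hodge conjecture.
[cite: MoonenZarhin1999LowDim, §2, §3 (3.2) and §5 (5.2)] [cite: vanGeemen1994HodgeAV, Lemma 3.7] -/
theorem hodgeConjectureFor_of_isIsogenous_powSucc_of_mtRank_le_six_of_dim_le_four (hX : IsSmoothProjective n X.X)
    (h0 : 0 < X.dim)
    (hcm : ¬ IsOfCMType X)
    (h6 : haveI := BettiUniverse.finite hX 1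
      (BettiUniverse.hodge exists_isReal_hodgeModel_holds hX 1).mtRank ≤ 6)
    (h4 : X.dim ≤ 4) {A : AbelianVariety ℂ} {N : ℕ} (hA : A.IsIsogenous (X.powSucc N)) :
    HodgeConjectureFor A.dim A.X :=
  HodgeConjectureFor.of_isIsogenous hA (hodgeConjectureFor_powSucc_of_mtRank_le_six_of_dim_le_four hX h0 hcm h6 h4 N)

end Summit.HodgeConjecture.CorCM

end
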